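import Summits.Schanuel.Schanuel.Theorems.DiophantineDichotomyApproximationPropertyDefs
import HarnessLib

/-!
# Vocabulary of the DEFICIENT-RANK lever of line `orbit-interpolation-determinant` (crux `ApproximationProperty`, stmt-Schanuel-6117)

Route `DiophantineDichotomy` (sub-problem `Schanuel/Schanuel`), crux
`Summit.Schanuel.Schanuel.Theses.DiophantineDichotomy.ApproximationProperty`, line
`orbit-interpolation-determinant`, lead c8 (`prover-line-stmt-Schanuel-6117-c8-0`), skeleton v20/v21
(`Cruxes/ApproximationProperty/Lines/orbit_interpolation_determinant.lean`), memo `Cruxes/ApproximationProperty/KERNEL-c8.md` §4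
(= lead c6's reduction R1, `KERNEL-c6.md`). Definitions module, same design as
`DiophantineDichotomyApproximationPropertyDefs.lean` (p80550) and `…CycleAPIAt3Defs.lean` (p121319):
nothing is asserted, every `def … : Prop` is a statement proved by a registered stub file
(`--supports stmt-Schanuel-6117`); the one `theorem` is the glue `SharpClosestPointDeficient → SharpClosestPoint`
(registered sub-goal `sharpClosestPoint_of_deficient`).

The landed lever `OrbitClusterBound` / transfer `SharpClosestPoint` / `pointDatum_of_clause` certify the
closest conjugate of a Galois orbit `Z = V(𝔭)` whose points impose INDEPENDENT conditions on the forms of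
degree `δ` (the interpolation clause `H(𝔭; δ) = deg 𝔭`). The deficient-rank versions below only ask that
the orbit imposes a FIXED FRACTION of the maximal number of conditions, `K₀ · H(𝔭; δ) ≥ deg 𝔭`: the
interpolation determinant is run on a maximal non-singular MINOR (`r = H(𝔭; δ)` rows and `r`
`ℚ`-independent monomials), the conjugate minors are multiplied over the complex embeddings of a Galois
hull of the field of the point (norm to `ℚ`, sharp ideal-theoretic denominators), and the cluster counts
are averaged (transitivity of the Galois action on embeddings + Jensen), so the clustering exponent
`k^{1+1/t}` degrades to `(kr/D)^{1+1/t}` only — a CONSTANT factor when `r ≥ D/K₀`. Consequence for the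
crux's open kernel (far stub of the skeleton): a BAD orbit must impose fewer than `deg 𝔭 / K₀` conditions
at level `⌊C₄Δ⌋`, for constants `K₀, C₄` of our choice.

* `OrbitClusterBoundDeficient` — the deficient lever (registered stub `orbitClusterBoundDeficient_of`
  derives it from the number-field kit `embedding_kit` and the convexity step `jensen_rpow_gain`);
* `ZeroDimDictionaryDeficient` — the 0-dimensional dictionary with the extra clause (E′): in the chart
  `b₀ ≠ 0`, `r ≤ H(𝔭; δ)` `ℚ`-INDEPENDENT monomials of degree `≤ δ` in `bⱼ/b₀` exist (rank–nullity for
  the evaluation map `ℚ[x]_δ → K`, kernel `𝔭_δ`);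
* `SharpClosestPointDeficient` — the sharp closest-point property under the near-clause
  `deg 𝔭 + K₀·dim(ℚ[x]_δ ∩ 𝔭) ≤ K₀·dim ℚ[x]_δ`, constants depending on `m` and `K₀`.

Sources: NesterenkoPhilippon2001 (LNM 1752) Ch. 3 §4 (Prop. 4.13); LaurentRoy1999 (interpolation
determinants); the line's memos KERNEL-c6.md (R1), KERNEL-c8.md (§4).
-/

noncomputable section

-- `Summit.Schanuel.Schanuel.…` is the mandated summit/sub-problem namespace (single-conjunct summit), hence:
set_option linter.dupNamespace false

attribute [local instance] MvPolynomial.gradedAlgebra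

namespace Summit.Schanuel.Schanuel.Cruxes.ApproximationProperty.OrbitInterpolationDeterminant

open Literature.NumberTheory.Transcendental.Nesterenko MvPolynomial
open scoped BigOperators

/-- **`OrbitClusterBoundDeficient`** — conjugate clustering costs `(kr/D)^{1+1/t}` for `r` independent
monomials: for `t ≥ 1` there are `c₀, C > 0` such that for a number field `K` (`D = [K:ℚ]`),
`β ∈ Kᵗ`, `r ≥ 1` exponent vectors `αⱼ` of total degree `≤ δ` whose monomials `β^{αⱼ}` are
`ℚ`-linearly independent, and `k` distinct complex embeddings putting `σᵢ(β)` in the sup-ball of radius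
`rad ≤ 1` about `x ∈ ℂᵗ`:
`(c₀ (kr/D)^{1+1/t} − kr/D) · log(1/rad) ≤ C · (δ (r/D) h_K(1:β) + r log(D+1) + (kr/D) δ log(2+‖x‖) + (kr/D) log(δ+2))`
(`h_K` = Mathlib's `Height.logHeight` relative to `K`). For `r = D` this is `OrbitClusterBound`. -/
def OrbitClusterBoundDeficient : Prop :=
  ∀ t : ℕ, 1 ≤ t → ∃ c₀ : ℝ, 0 < c₀ ∧ ∃ C : ℝ, 0 < C ∧ ∀ (K : Type) [Field K] [NumberField K] (β : Fin t → K) (δ k r : ℕ) (α : Fin r → Fin t → ℕ) (σ : Fin k → (K →+* ℂ)) (x : Fin t → ℂ) (rad : ℝ), 1 ≤ r → (∀ j, ∑ l, α j l ≤ δ) → LinearIndependent ℚ (fun j => ∏ l, β l ^ α j l) → Function.Injective σ → 0 < rad → rad ≤ 1 → (∀ i, ‖(fun j => σ i (β j)) - x‖ ≤ rad) → (c₀ * ((k : ℝ) * r / Module.finrank ℚ K) ^ (1 + 1 / (t : ℝ)) - (k : ℝ) * r / Module.finrank ℚ K) * Real.log (1 / rad) ≤ C * (δ * ((r : ℝ)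 / Module.finrank ℚ K) * Height.logHeight (Fin.cons (1 : K) β : Fin (t + 1) → K) + r * Real.log (Module.finrank ℚ K + 1) + (k : ℝ) * r / Module.finrank ℚ K * δ * Real.log (2 + ‖x‖) + (k : ℝ) * r / Module.finrank ℚ K * Real.log ((δ : ℝ) + 2))

/-- **`ZeroDimDictionaryDeficient`** — `ZeroDimDictionary` (clauses (A), (B′), (B), (C), (D), (E) verbatim)
with the extra clause (E′): in the chart `b₀ ≠ 0`, for every degree `δ` and every
`r ≤ H(𝔭; δ) = dim ℚ[x]_δ − dim (ℚ[x]_δ ∩ 𝔭)` there are `r` exponent vectors of total degree `≤ δ`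
whose monomials in the affine coordinates `bⱼ/b₀` are `ℚ`-linearly independent in `K` (the evaluation
map `ℚ[x]_δ → K` has kernel `𝔭_δ`, hence rank `H(𝔭; δ)`, and the monomials span `ℚ[x]_δ`). -/
def ZeroDimDictionaryDeficient : Prop :=
  ∀ m : ℕ, 1 ≤ m → ∃ c : ℝ, 0 < c ∧
    ∀ 𝔭 : Ideal (Rx m), 𝔭.IsPrime → 𝔭.IsHomogeneous (homogeneousSubmodule (Fin (m + 1)) ℚ) →
      IsUnmixedOfRank 𝔭 1 →
      ∃ (K : Type) (_ : Field K) (_ : NumberField K) (b : Fin (m + 1) → K), b ≠ 0 ∧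
        (∀ β : Fin (m + 1) → ℂ, β ∈ projZeros 𝔭 ↔
          β ≠ 0 ∧ ∃ (σ : K →+* ℂ) (l : ℂ), β = fun j => l * σ (b j)) ∧
        (∀ (σ τ : K →+* ℂ) (l : ℂ), (fun j => σ (b j)) = (fun j => l * τ (b j)) → σ = τ) ∧
        Module.finrank ℚ K = ideg 𝔭 1 ∧
        Height.logHeight b ≤ iheight 𝔭 1 + c * ideg 𝔭 1 ∧
        (∀ ω : Fin (m + 1) → ℂ, ω ≠ 0 →
          Real.exp (-(c * ideg 𝔭 1)) * ∏ σ : K →+* ℂ, projDist ω (fun j => σ (b j)) ≤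
            iabs 𝔭 1 ω) ∧
        (b 0 ≠ 0 → ∀ δ : ℕ,
          Module.finrank ℚ ↥(homogeneousSubmodule (Fin (m + 1)) ℚ δ) =
            Module.finrank ℚ ↥(homogeneousSubmodule (Fin (m + 1)) ℚ δ ⊓ 𝔭.restrictScalars ℚ) +
              ideg 𝔭 1 →
          ∀ z : K, ∃ Q : MvPolynomial (Fin m) ℚ, Q.totalDegree ≤ δ ∧
            MvPolynomial.aeval (fun j : Fin m => b j.succ / b 0) Q = z) ∧
        (b 0 ≠ 0 → ∀ δ r : ℕ,
          r + Module.finrank ℚ ↥(homogeneousSubmodule (Fin (m + 1)) ℚ δ ⊓ 𝔭.restrictScalars ℚ) ≤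
            Module.finrank ℚ ↥(homogeneousSubmodule (Fin (m + 1)) ℚ δ) →
          ∃ α : Fin r → Fin m → ℕ, (∀ j, ∑ l, α j l ≤ δ) ∧
            LinearIndependent ℚ (fun j => ∏ l, (b l.succ / b 0) ^ α j l))

/-- **`SharpClosestPointDeficient`**: for every `m ≥ 1` and `K₀ ≥ 1` there are `C > 0` (independent of
`ℓ`) and `ℓ₀`, and for every `ℓ ≥ ℓ₀` a constant `C' > 0`, such that for a homogeneous prime
`𝔭 ⊂ ℚ[x₀, …, x_m]` of rank `1` whose zeros impose AT LEAST `deg 𝔭 / K₀` conditions on the forms of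
degree `δ` (`deg 𝔭 + K₀·dim(ℚ[x]_δ ∩ 𝔭) ≤ K₀·dim ℚ[x]_δ`) and an affine point `(1 : ω)`, some zero `β`
of `𝔭` satisfies
`‖(1:ω) − β‖^ℓ ≤ |𝔭(1:ω)| · exp(C δ h(𝔭)/ℓ^{1/m} + C' deg 𝔭 ((δ+1)(log(2+‖ω‖) + 1) + log(deg 𝔭 + 1)))`.
For `K₀ = 1` this is `SharpClosestPoint`. -/
def SharpClosestPointDeficient : Prop :=
  ∀ m : ℕ, 1 ≤ m → ∀ K₀ : ℕ, 1 ≤ K₀ → ∃ C : ℝ, 0 < C ∧ ∃ ℓ₀ : ℕ, ∀ ℓ : ℕ, ℓ₀ ≤ ℓ → ∃ C' : ℝ, 0 < C' ∧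
    ∀ (𝔭 : Ideal (Rx m)) (δ : ℕ) (ω : Fin m → ℂ), 𝔭.IsPrime →
      𝔭.IsHomogeneous (homogeneousSubmodule (Fin (m + 1)) ℚ) → IsUnmixedOfRank 𝔭 1 →
      ideg 𝔭 1 + K₀ * Module.finrank ℚ ↥(homogeneousSubmodule (Fin (m + 1)) ℚ δ ⊓ 𝔭.restrictScalars ℚ) ≤
        K₀ * Module.finrank ℚ ↥(homogeneousSubmodule (Fin (m + 1)) ℚ δ) →
      ∃ β ∈ projZeros 𝔭,
        projDist (Fin.cons 1 ω) β ^ ℓ ≤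
          iabs 𝔭 1 (Fin.cons 1 ω) *
            Real.exp (C * δ * iheight 𝔭 1 / (ℓ : ℝ) ^ (1 / (m : ℝ)) +
              C' * ideg 𝔭 1 *
                ((δ + 1) * (Real.log (2 + ‖ω‖) + 1) + Real.log ((ideg 𝔭 1 : ℝ) + 1)))

/-! ## Glue (kernel-checked bookkeeping): the deficient statements specialise to the landed ones -/

/-- **`SharpClosestPointDeficient → SharpClosestPoint`** (registered sub-goal `sharpClosestPoint_of_deficient`,
so that this definitions module lands `--supports`): at `K₀ = 1` the near-clause
`deg 𝔭 + dim(ℚ[x]_δ ∩ 𝔭) ≤ dim ℚ[x]_δ` is implied by the interpolation clause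
`dim ℚ[x]_δ = dim(ℚ[x]_δ ∩ 𝔭) + deg 𝔭`, and the two conclusions coincide. [folklore] -/
theorem sharpClosestPoint_of_deficient : SharpClosestPointDeficient → SharpClosestPoint := by
  intro h m hm
  obtain ⟨C, hC, ℓ₀, hℓ⟩ := h m hm 1 le_rfl
  refine ⟨C, hC, ℓ₀, fun ℓ hℓ₀ => ?_⟩
  obtain ⟨C', hC', hmain⟩ := hℓ ℓ hℓ₀
  refine ⟨C', hC', fun 𝔭 δ ω h𝔭 hhom hunm hclause => ?_⟩
  exact hmain 𝔭 δ ω h𝔭 hhom hunm (by rw [one_mul, one_mul, hclause, add_comm])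

end Summit.Schanuel.Schanuel.Cruxes.ApproximationProperty.OrbitInterpolationDeterminant

end
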